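import Summits.ResolutionOfSingularities.ResolutionOfSingularities.Theorems.EquisingularLiftEquisingularLiftNatHostedSubchainPointResolution
import Summits.ResolutionOfSingularities.ResolutionOfSingularities.Theorems.EquisingularLiftEquisingularLiftNatHyperplaneLetter
import Summits.ResolutionOfSingularities.ResolutionOfSingularities.Theorems.EquisingularLiftEquisingularLiftNatLinearFormSectionLift
import HarnessLib

/-!
# [OURS · L1 W4.5(b) · EL♮(3) · WIDTH TABLE D4, K5ʰ supplier HINIT] THE INITIAL HOST'S MODEL: the trivial host `∅` (model `⊤`) and a HYPERPLANE host `V₊(ℓ)`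
# (`TCPlus.letterDatum_empty`, `hinit_empty`, `hinit_hyperplane`)

res-L1-w45b-stub-2 g15 (desk R43 (4): «stub-2 v2.1 engine → 027 D4-1 …»; the HINIT seam of ✓ p660091 `target_elnat_of_hostedSubchainResolution`).  OURS; NOT a
statement of any manuscript; AI-written, weaker than expert review.  No `sorry`; standard axioms; DEF-FREE.  `--supports stmt-ResolutionOfSingularities-20148 --as helper`.

* `TCPlus.letterDatum_empty` — the EMPTY host has the model `⊤` at every stage (res-type-027's `TCPlus.LetterDatum`, clauses (l-i)–(l-v) trivially: `⊤·𝒪_G = ⊤ =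
  𝓘⟨closure ∅⟩`, principal, `V(⊤) = ∅` regular, support `∅`, flat).  This — NOT `univ` with `⊥`, whose support violates (l-iv) — is the TRIVIAL HOST of the hosted
  nose blob (this seat STATUS 2026-08-28T19:05:51Z; res-L1-w45b-stub-4 19:06:03Z concordant); `hinit_empty` = ✓ p660091's HINIT hypothesis at `E₀ = ∅`.
* `hinit_hyperplane` — ✓ p660091's HINIT hypothesis at `E₀ = V₊(ℓ) = {y | ℓ ∈ 𝔭_y}` for a non-zero LINEAR form `ℓ ∈ k[x₀,…,x_{r+1}]` with `H ⊄ V₊(ℓ)`: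
  lift `ℓ`'s coefficients through `θ` (one of them is a unit since `θ` is onto a field with kernel `𝔪_O`) and apply res-type-027's ✓ `TCPlus.letterDatum_hyperplane`.
-/

set_option linter.dupNamespace false -- mandated namespace `Summit.<Summit>.<Problem>` of this single-conjunct summit
set_option linter.overlappingInstances false -- signatures carry `[IsDomain O] [IsDiscreteValuationRing O]`

noncomputable section

open CategoryTheory CategoryTheory.Limits AlgebraicGeometry TopologicalSpace Topology
open MvPolynomial
open Literature.AlgebraicGeometry.Resolution
open AlgebraicGeometry.Scheme.IdealSheafData

namespace Summit.ResolutionOfSingularities.ResolutionOfSingularities.Cruxes.EquisingularLiftNat.Sections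

/-- **The EMPTY host has the model `⊤`** (a `TCPlus.LetterDatum` at every stage). [OURS · elementary] -/
theorem TCPlus.letterDatum_empty (O : Type) [CommRing O] [IsDomain O] [IsDiscreteValuationRing O] (P : Scheme.{0})
    (q : P ⟶ Spec (.of O)) (Y : Set P) (G X : Scheme.{0}) (σ : X ⟶ P) (jG : G ⟶ X) :
    TCPlus.LetterDatum O P q Y G X σ jG (∅ : Set G) := by
  haveI hE : IsEmpty (↥((⊤ : X.IdealSheafData).subscheme)) := by
    rw [← (Scheme.IdealSheafData.subschemeι _).ker_eq_top_iff_isEmpty, Scheme.IdealSheafData.ker_subschemeι]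
  refine ⟨⊤, ?_, fun z => ?_, fun x => isEmptyElim x, ?_, inferInstance⟩
  · rw [Scheme.IdealSheafData.comap_top, eq_comm, ← Scheme.IdealSheafData.support_eq_bot_iff]
    ext g
    simp [Scheme.IdealSheafData.coe_support_vanishingIdeal]
  · rw [stalkIdeal_top]; exact ⟨⟨1, by simp⟩⟩
  · rw [Scheme.IdealSheafData.support_top]; simp

/-- **HINIT at the trivial host `E₀ = ∅`** (✓ p660091's first supplier hypothesis, verbatim at `∅`). [OURS · elementary] -/
theorem hinit_empty (k : Type) [Field k] (n : ℕ) (H : AlgebraicGeometry.Scheme.{0})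
    (ι : H ⟶ (Literature.AlgebraicGeometry.Motives.projectiveSpace n k).left) :
    ∀ (O : Type) [CommRing O] [IsDomain O] [IsDiscreteValuationRing O] [IsAdicComplete (IsLocalRing.maximalIdeal O) O]
        [IsAlgClosed (IsLocalRing.ResidueField O)] (θ : O →+* k), Function.Surjective θ → (letI := MvPolynomial.gradedAlgebra (σ := Fin (n + 1)) (R := O);
       letI := MvPolynomial.gradedAlgebra (σ := Fin (n + 1)) (R := k); ∀ (φ : MvPolynomial.homogeneousSubmodule (Fin (n + 1)) O →+*ᵍ MvPolynomial.homogeneousSubmodule (Fin (n + 1)) k)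
        (hφ' : HomogeneousIdeal.irrelevant (MvPolynomial.homogeneousSubmodule (Fin (n + 1)) k) ≤ (HomogeneousIdeal.irrelevant (MvPolynomial.homogeneousSubmodule (Fin (n + 1)) O)).map φ),
        (∀ s, φ s = MvPolynomial.map θ s) →
        TCPlus.LetterDatum O (AlgebraicGeometry.Proj (MvPolynomial.homogeneousSubmodule (Fin (n + 1)) O)) (AlgebraicGeometry.Proj.toSpecZero (MvPolynomial.homogeneousSubmodule (Fin (n + 1)) O) ≫ AlgebraicGeometry.Spec.map (CommRingCat.ofHom (algebraMap O (MvPolynomial.homogeneousSubmodule (Fin (n + 1)) O 0)))) (Set.range (ι ≫ AlgebraicGeometry.Proj.map φ hφ' : H ⟶ (AlgebraicGeometry.Proj (MvPolynomial.homogeneousSubmodule (Fin (n + 1)) O)))) (Literature.AlgebraicGeometry.Motives.projectiveSpace n k).left (AlgebraicGeometry.Proj (MvPolynomial.homogeneousSubmodule (Fin (n + 1)) O)) (𝟙 (AlgebraicGeometry.Proj (MvPolynomial.homogeneousSubmodule (Fin (n + 1)) O))) (AlgebraicGeometry.Proj.map φ hφ' : (Literature.AlgebraicGeometry.Motives.projectiveSpace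 n k).left ⟶ (AlgebraicGeometry.Proj (MvPolynomial.homogeneousSubmodule (Fin (n + 1)) O))) (∅ : Set (Literature.AlgebraicGeometry.Motives.projectiveSpace n k).left)) := by
  intro O _ _ _ _ _ θ _
  letI := MvPolynomial.gradedAlgebra (σ := Fin (n + 1)) (R := O)
  letI := MvPolynomial.gradedAlgebra (σ := Fin (n + 1)) (R := k)
  intro φ hφ' _
  exact TCPlus.letterDatum_empty O _ _ _ _ _ _ _

/-- **HINIT at a HYPERPLANE host `E₀ = V₊(ℓ)`** (✓ p660091's first supplier hypothesis at `n = r + 1`), `ℓ` a non-zero linear form with `H ⊄ V₊(ℓ)`: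
lift the coefficients through `θ` (a unit coefficient exists) and apply res-type-027's `TCPlus.letterDatum_hyperplane`. [OURS · elementary composition] -/
theorem hinit_hyperplane (k : Type) [Field k] (r : ℕ) (H : AlgebraicGeometry.Scheme.{0}) [AlgebraicGeometry.IsIntegral H]
    (ι : H ⟶ (Literature.AlgebraicGeometry.Motives.projectiveSpace (r + 1) k).left) [AlgebraicGeometry.IsClosedImmersion ι]
    (ℓ : MvPolynomial (Fin (r + 1 + 1)) k) (hℓ1 : ℓ.IsHomogeneous 1) (hℓ0 : ℓ ≠ 0)
    (hH : letI := MvPolynomial.gradedAlgebra (σ := Fin (r + 1 + 1)) (R := k);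
      ¬ Set.range ι ⊆ {y : (Literature.AlgebraicGeometry.Motives.projectiveSpace (r + 1) k).left | ℓ ∈ y.asHomogeneousIdeal}) :
    ∀ (O : Type) [CommRing O] [IsDomain O] [IsDiscreteValuationRing O] [IsAdicComplete (IsLocalRing.maximalIdeal O) O]
        [IsAlgClosed (IsLocalRing.ResidueField O)] (θ : O →+* k), Function.Surjective θ → (letI := MvPolynomial.gradedAlgebra (σ := Fin (r + 1 + 1)) (R := O);
       letI := MvPolynomial.gradedAlgebra (σ := Fin (r + 1 + 1)) (R := k); ∀ (φ : MvPolynomial.homogeneousSubmodule (Fin (r + 1 + 1)) O →+*ᵍ MvPolynomial.homogeneousSubmodule (Fin (r + 1 + 1)) k)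
        (hφ' : HomogeneousIdeal.irrelevant (MvPolynomial.homogeneousSubmodule (Fin (r + 1 + 1)) k) ≤ (HomogeneousIdeal.irrelevant (MvPolynomial.homogeneousSubmodule (Fin (r + 1 + 1)) O)).map φ),
        (∀ s, φ s = MvPolynomial.map θ s) →
        TCPlus.LetterDatum O (AlgebraicGeometry.Proj (MvPolynomial.homogeneousSubmodule (Fin (r + 1 + 1)) O)) (AlgebraicGeometry.Proj.toSpecZero (MvPolynomial.homogeneousSubmodule (Fin (r + 1 + 1)) O) ≫ AlgebraicGeometry.Spec.map (CommRingCat.ofHom (algebraMap O (MvPolynomial.homogeneousSubmodule (Fin (r + 1 + 1)) O 0)))) (Set.range (ι ≫ AlgebraicGeometry.Proj.map φ hφ' : H ⟶ (AlgebraicGeometry.Proj (MvPolynomial.homogeneousSubmodule (Fin (r + 1 + 1)) O)))) (Literature.AlgebraicGeometry.Motives.projectiveSpace (r + 1) k).left (AlgebraicGeometry.Proj (MvPolynomial.homogeneousSubmodule (Fin (r + 1 + 1)) O)) (𝟙 (AlgebraicGeometry.Proj (MvPolynomial.homogeneousSubmodule (Fin (r + 1 + 1)) O))) (AlgebraicGeometry.Proj.map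 φ hφ' : (Literature.AlgebraicGeometry.Motives.projectiveSpace (r + 1) k).left ⟶ (AlgebraicGeometry.Proj (MvPolynomial.homogeneousSubmodule (Fin (r + 1 + 1)) O))) {y : (Literature.AlgebraicGeometry.Motives.projectiveSpace (r + 1) k).left | ℓ ∈ y.asHomogeneousIdeal}) := by
  classical
  intro O _ _ _ _ _ θ hθ
  letI := MvPolynomial.gradedAlgebra (σ := Fin (r + 1 + 1)) (R := O)
  letI := MvPolynomial.gradedAlgebra (σ := Fin (r + 1 + 1)) (R := k)
  intro φ hφ' hφ
  -- lift the coefficients of `ℓ`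
  let cbar : Fin (r + 1 + 1) → k := fun j => coeff (Finsupp.single j 1) ℓ
  let c : Fin (r + 1 + 1) → O := fun j => Function.surjInv hθ (cbar j)
  have hc : ∀ j, θ (c j) = cbar j := fun j => Function.surjInv_eq hθ (cbar j)
  have hℓsum : ℓ = ∑ j, C (cbar j) * X j := LetterLift.eq_sum_coeff_single_mul_X_of_isHomogeneous_one ℓ hℓ1
  have hmap : MvPolynomial.map θ (∑ j, C (c j) * X j) = ℓ := by
    rw [map_sum]
    simp only [map_mul, map_C, map_X, hc]
    exact hℓsum.symm
  -- a unit coefficient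
  obtain ⟨a, ha⟩ : ∃ a, cbar a ≠ 0 := by
    by_contra hall
    push Not at hall
    apply hℓ0
    rw [hℓsum]
    exact Finset.sum_eq_zero fun j _ => by rw [hall j, C_0, zero_mul]
  have hunit : IsUnit (c a) := by
    by_contra hna
    have hmem : c a ∈ IsLocalRing.maximalIdeal O := (IsLocalRing.mem_maximalIdeal _).mpr hna
    rw [← IsLocalRing.eq_maximalIdeal (RingHom.ker_isMaximal_of_surjective θ hθ), RingHom.mem_ker] at hmem
    exact ha (by rw [← hc a]; exact hmem)
  obtain ⟨w, hw⟩ := hunit.exists_right_inv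
  let ι' : H ⟶ Proj (homogeneousSubmodule (Fin (r + 1 + 1)) k) := ι
  haveI : IsClosedImmersion ι' := ‹AlgebraicGeometry.IsClosedImmersion ι›
  exact TCPlus.letterDatum_hyperplane θ hθ φ hφ hφ' c a w hw hmap ι' hH rfl

end Summit.ResolutionOfSingularities.ResolutionOfSingularities.Cruxes.EquisingularLiftNat.Sections

end
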